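import Summits.CriticalPhenomena.PercolationContinuityZ3.Theses.PercTorusSliceFilling

/-!
# Route `PercTorusSliceFilling`, item `ThinClusterTransport` — Markov glue

`SliceFillingTransport → ThinClusterTransport`: given the transport bound
`E_{T_n,p}[N_sf] ≤ n³ · E_{ℤ³,p}[1{A_m}/|C^{B(m)}(0)|]`, `m = ⌊(n-2)/2⌋`, `n ≥ 4`, and thin-cluster
rarity `E_{p_c}[1{A_m}/|C^{B(m)}(0)|] ≤ C/m³`, we get `E N_sf ≤ n³ C/m³ ≤ 125 C` for `n ≥ 4`
(`n ≤ 5m`), while `N_sf ≤ 27` deterministically for `n = 3`; Markov's inequality finishes.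
-/

namespace Summit.CriticalPhenomena.PercolationContinuityZ3.Theorems

open MeasureTheory Filter Set
open Literature.Probability.Percolation Literature.Probability.LatticeModels
open Summit.CriticalPhenomena.PercolationContinuityZ3.Theses.PercTorusSliceFilling

namespace PercTorusSliceFillingThinClusterTransport

/-- The number of slice-filling clusters of a configuration on the torus `T_n` (`n ≥ 1`) is at
most the number `n³` of vertices. [folklore] -/
theorem ncard_sliceFilling_le (n : ℕ) [NeZero n]
    (ω : BondConfig (TorusSite 3 n)) :
    Set.ncard {S : Set (TorusSite 3 n) | (∃ x, S = openCluster ω x) ∧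
      ∃ i : Fin 3, ∀ t : ZMod n, ∃ y ∈ S, y i = t} ≤ n ^ 3 := by
  classical
  have hsub : {S : Set (TorusSite 3 n) | (∃ x, S = openCluster ω x) ∧
      ∃ i : Fin 3, ∀ t : ZMod n, ∃ y ∈ S, y i = t} ⊆
      ↑((Finset.univ : Finset (TorusSite 3 n)).image (openCluster ω)) := by
    rintro S ⟨⟨x, rfl⟩, -⟩
    simp
  calc Set.ncard {S : Set (TorusSite 3 n) | (∃ x, S = openCluster ω x) ∧
          ∃ i : Fin 3, ∀ t : ZMod n, ∃ y ∈ S, y i = t}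
        ≤ Set.ncard (↑((Finset.univ : Finset (TorusSite 3 n)).image (openCluster ω)) :
            Set (Set (TorusSite 3 n))) := Set.ncard_le_ncard hsub (Finset.finite_toSet _)
    _ = ((Finset.univ : Finset (TorusSite 3 n)).image (openCluster ω)).card :=
          Set.ncard_coe_finset _
    _ ≤ (Finset.univ : Finset (TorusSite 3 n)).card := Finset.card_image_le
    _ = n ^ 3 := by simp [Finset.card_univ, ZMod.card]

/-- **Markov glue.** `SliceFillingTransport → ThinClusterTransport`. [folklore] -/
theorem thinClusterTransport_of_sliceFillingTransport (hT : SliceFillingTransport) :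
    ThinClusterTransport := by
  classical
  unfold ThinClusterTransport
  rintro ⟨C, hC⟩ δ hδ
  -- the ℤ³ functional
  set I : ℕ → ℝ := fun m => ∫ ω, (siteToBoundary 3 m).indicator
      (fun ω => ((Set.ncard {y : Site 3 | ω ∈ openConnIn (↑(box 3 m)) 0 y} : ℝ))⁻¹) ω
      ∂(bondPercolation (zdGraph 3) (criticalProbI 3)) with hI
  have hI_nonneg : ∀ m, 0 ≤ I m := fun m =>
    integral_nonneg fun ω => Set.indicator_nonneg (fun _ _ => inv_nonneg.2 (Nat.cast_nonneg _)) _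
  have hC0 : 0 ≤ C := by
    have h1 := hC 1 le_rfl
    simp only [Nat.cast_one, one_pow, div_one] at h1
    exact (hI_nonneg 1).trans h1
  -- choice of `M`
  obtain ⟨M, hM28, hMC⟩ : ∃ M : ℕ, 28 ≤ M ∧ 125 * C / δ < M := by
    obtain ⟨N, hN⟩ := exists_nat_gt (125 * C / δ)
    exact ⟨max 28 N, le_max_left _ _, hN.trans_le (by exact_mod_cast le_max_right 28 N)⟩
  have hMpos : (0 : ℝ) < M := by exact_mod_cast (show 0 < M by omega)
  refine ⟨M, fun n hn => ?_⟩
  haveI : NeZero n := ⟨by omega⟩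
  -- the torus functional
  set N : BondConfig (TorusSite 3 n) → ℕ := fun ω => Set.ncard {S : Set (TorusSite 3 n) |
      (∃ x, S = openCluster ω x) ∧ ∃ i : Fin 3, ∀ t : ZMod n, ∃ y ∈ S, y i = t} with hN
  set μ := bondPercolation (torusGraph 3 n) (criticalProbI 3) with hμ
  show μ.real {ω | M ≤ N ω} ≤ δ
  rcases Nat.lt_or_ge n 4 with hn3 | hn4
  · -- `n = 3`: no configuration has `≥ 28` clusters
    have hn3' : n = 3 := by omega
    have hempty : {ω | M ≤ N ω} = ∅ := by
      ext ω
      simp only [Set.mem_setOf_eq, Set.mem_empty_iff_false, iff_false, not_le, hN]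
      have h := ncard_sliceFilling_le n ω
      have h27 : n ^ 3 = 27 := by rw [hn3']; norm_num
      omega
    rw [hempty, measureReal_empty]
    exact hδ.le
  · -- `n ≥ 4`: Markov
    have hint : Integrable (fun ω => (N ω : ℝ)) μ := Integrable.of_finite
    have hnonneg : 0 ≤ᵐ[μ] (fun ω => (N ω : ℝ)) := Eventually.of_forall fun ω => Nat.cast_nonneg _
    have hmarkov := mul_meas_ge_le_integral_of_nonneg hnonneg hint (M : ℝ)
    have hset : {ω | (M : ℝ) ≤ (N ω : ℝ)} = {ω | M ≤ N ω} := by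
      ext ω; simp only [Set.mem_setOf_eq, Nat.cast_le]
    rw [hset] at hmarkov
    -- transport + rarity
    set m := (n - 2) / 2 with hm
    have hm1 : 1 ≤ m := by omega
    have hn5m : n ≤ 5 * m := by omega
    have hEN : ∫ ω, (N ω : ℝ) ∂μ ≤ (n : ℝ) ^ 3 * I m := hT (criticalProbI 3) n hn4
    have hIm : I m ≤ C / (m : ℝ) ^ 3 := hC m hm1
    have hmpos : (0 : ℝ) < m := by exact_mod_cast hm1
    have hbound : ∫ ω, (N ω : ℝ) ∂μ ≤ 125 * C := by
      calc ∫ ω, (N ω : ℝ) ∂μ ≤ (n : ℝ) ^ 3 * I m := hEN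
        _ ≤ (n : ℝ) ^ 3 * (C / (m : ℝ) ^ 3) := by gcongr
        _ = (n / m : ℝ) ^ 3 * C := by rw [div_pow]; ring
        _ ≤ (5 : ℝ) ^ 3 * C := by
            gcongr
            rw [div_le_iff₀ hmpos]
            exact_mod_cast hn5m
        _ = 125 * C := by norm_num
    have h1 : (M : ℝ) * μ.real {ω | M ≤ N ω} ≤ 125 * C := hmarkov.trans hbound
    have h2 : 125 * C < M * δ := by rwa [div_lt_iff₀ hδ] at hMC
    by_contra hcon
    push Not at hcon
    have : (M : ℝ) * δ < (M : ℝ) * μ.real {ω | M ≤ N ω} := by gcongr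
    linarith

end PercTorusSliceFillingThinClusterTransport

end Summit.CriticalPhenomena.PercolationContinuityZ3.Theorems
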